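import Summits.QuantumFields.YangMills.Theorems.BalabanUVNodesN15TwoGridDressedUnitLayerN15At
import Summits.QuantumFields.YangMills.Theorems.BalabanUVNodesN15FullPropagatorC2BgExactUnitN15At
import HarnessLib

/-!
# N15 (NE2) — PROGRAMME Σ, part Σ-A: ★★★ THE SITE LAYER OF THE PAIR OF RECORD WITH THE BACKGROUND LIVE — `NE2PlusSite` BY NAME for the U-SEEING site kernel
# `S(U) = (Q E₀ˢ(U) Q*)⁻¹ = b·1 + Δ^{(n)} + P_ex^{(n)}(U)` (Bałaban's (1.102)–(1.103) map at the dressed propagator, EXACT inverse), AND `N15At` WITH ALL THREE LAYERS READING `U`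

WHO ∕ WHEN.  Cell `pub-ymgap`, seat `pub-ymgap-dag-n15-a` (KNIT-BY-NAME seat of Track-A DAG node N15 = NE2, g28); `--supports stmt-QuantumFields-27366 --as helper` (K3⁸; count-neutral).
Three plumbing `def`s (the dressed effective operator `sitePolEx`, the U-seeing site kernel `foSiteBg`, the `NE2Objects₁₁` literal `allLayersBgObjects`) + theorems.  Over Λ-F
`…TwoGridDressedUnitLayerN15At` (`foCovBg`, ★★★ `ne2PlusUnit_foCovBg`, `dvd_Mn_S`), Λ-E `…TwoGridDressedUnitLayerLetters` (★★★ `zOp_letters_FO`), V-D `…FullPropagatorC2BgExactUnitN15At`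
(`bgPertEx`, `bgPertEx_zero`, ★★ `deltaPol_add_bgPertEx_eq_inv_symProp`), V-C `…UnitLayerBgExactDressingLetters` (★★★ `exDress_deltaPol_letters`), V-A `…UnitLayerBgQGQPosition`
(`sOp`, `inv_unitBondMat_sOp`), Λ-C (★★★ `ne2PlusOperator_allEntries_fullG`), Λ-D (`live_foInstanceFG`), II-E (`foInstanceFG`, `coeffBgFO`, `reg335_coeffBgFO_iff`, `osc_rate_le`), G1
(`etaRateIneqSite_opGeo_unit`), `T4Cov2156Rate.kernelRate166`, `T4EtaRateCoeffDefect.fit_blockAvg`, n15-b (`fibreOsc_of_fgrad`, `blockAvg_zero`), part 27 (`rateWeight_unitTorusGeoS`) BY NAME;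
nothing in the tree is modified.  PATTERN = Λ-F (the unit layer), with U-A's covariance step absent: the site object IS the dressed effective operator.

WHY.  After Λ-C (operator layer, all four (3.42) entries) and Λ-F (unit layer) the SITE layer was the one U-blind layer left on the pair of record (HANDOFF §g27.6 (t3)): the knit
`allEntriesBgObjects` carries dag-n15-c G1's genuine `U ≡ 1` scalar kernel `(Q′G′²Q′*)⁻¹`.  §g27.6 sized (t3) «L» for want of a position-space dictionary to `(QΔ_a⁻¹Q*)⁻¹`; that dictionary
IS this lane's programme V (g17): V-A `inv_unitBondMat_sOp` (`(unitBondMat (Q Δ_b⁻¹ Q*))⁻¹ = b·1 + Δ^{(n)}`, the β cell's (1.102)–(1.103) `QGQ_inv_eq` transported) and V-D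
`deltaPol_add_bgPertEx_eq_inv_symProp` (`b·1 + Δ^{(n)} + P_ex^{(n)}(U) = (unitBondMat (Q E₀ˢ(U) Q*))⁻¹`, the EXACT inverse by finite Combes–Thomas, V-B∕V-C).  So the [B9] (3.132)-type
site object `(QG(U)Q*)⁻¹` at the operator layer's own dressed propagator is already a typed unit-bond matrix with majorant and two-grid letters — and Λ-E's `zOp_letters_FO` supplies its
middle factor on the (3.35)-pair family.  This file reads them out as the node's SECOND conjunct by name with the background LIVE, and knits the pair of record with NO U-blind layer.

WHAT.  §1 def `sitePolEx M n b c a := b·1 + deltaPol M n + bgPertEx M n b c a`; ★★ `sitePolEx_eq_inv_symProp` (`= (unitBondMat (Q_n E₀ˢ(U) Q_n*))⁻¹`, V-D verbatim), ★ `sitePolEx_zero`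
(at zero coefficients `= (unitBondMat (Q G Q*))⁻¹`, V-A), `sitePolEx_apply`; def `foSiteBg d hL b α β j` (`(U, y, y′) ↦ S^{(L^mL^k)}(U)((ȳ,α),(ȳ′,β)) − S^{(L^k)}(Ū)((ȳ,α),(ȳ′,β))`,
`Ū = (blockAvg c′, blockAvg a′_μ)`), `foSiteBg_ker`, ★ `foSiteBg_one` (at `U = 0` the kernel IS King's (1.66) η-difference `Δ^{(L^{k+m})} − Δ^{(L^k)}` at the bonds); §2 ★★★
**`ne2PlusSite_foSiteBg (hd : 1 ≤ d) (hLodd) (hL3 : 3 ≤ L) (hL) (hb) (hc₃₅) (α β) (d′ p) : NE2PlusSite d′ p c₃₅ (foInstanceFG d hL) (foSiteBg d hL b α β)`** — constants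
`(M₅, δ, a₀, C, γ₀) = (1, min(δ₁, δ′), min(r₁, ζ₀∕ζ)∕c₃₅, θ₀ + K(τ·c_T + 1) + 1, min(1∕16, 1∕(8(d+1))))`: the BACKGROUND IS READ, the SIZE IS LIVE (`(gf j).M = M_sz`, letters
`c₃₅·M_sz·α₀`), the threshold is a smallness of `M·α₀` alone, NO Neumann series, NO weight window; mechanism: `|S′(U) − S̄(Ū)| ≤ |Δ′ − Δ̄| + |P′_ex(U) − P̄_ex(Ū)|` ≤ King's (1.66) letter
`θ₀(L^k)⁻¹e^{−δ₁ρ}` + V-C (iii) `K(τT + (L^k)⁻¹)e^{−δ′ρ}`, `T ≤ c_T·(L^k)^{−γ₀}` (Λ-E's rate shape + the derived fit `fit_blockAvg ∘ fibreOsc_of_fgrad`); at unit sites the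
`(L^jη)^{−p}(L^{j′}η)^{−d′}` prefactors are `1` (G1 `etaRateIneqSite_opGeo_unit`).  §3 ★★★ **`n15At_allLayersBg`**: `N15At ⟨TGIndexS, c₃₅, p, foInstanceFG, foFamilyAllFG b ν κ, foSiteBg b α β,
foCovBg b α′ β′, ⊤, dist⟩` — OPERATOR (Λ-C, all four entries), SITE (§2) AND UNIT (Λ-F) ALL READ `U`; ★★ `live_allLayersBg` (the K3⁸ guard), ★★★ `live_and_n15At_allLayersBg`; def
`allLayersBgObjects` + `rfl` + faces (`n15At_∕live_allLayersBgObjects`, `s_N15_of_admits_allLayersBg`).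

HONEST FRAMING ∕ LIMITS.  By-name composition over LANDED rows; MODEL-LEVEL: abelianised first-order species of (3.52)'s `V′(A)` with block-averaged coarse partner (C3), abelianised `Q` (real
parts), symmetrisation in the bond basis (`E₀ˢ`); «site kernel» := the (3.132)-type `(QG(U)Q*)⁻¹` at the dressed propagator `E₀(U)` of the pair of record (the (3.48) scalar `(Q′G′²Q′*)⁻¹` of
G1 is the other site object; both live on unit sites, where `NE2PlusSite`'s `p` is not read); GENUINE: Bałaban's `Δ_a⁻¹`, THE (1.66) matrix, the (1.102)–(1.103) map, the exact inverse.
NOT [B9] Thms 3.2∕(3.132) at a general (3.35)-regular `U` for the NON-ABELIAN `G(U)` (NOT PRINTED as η-rates; n15-c's lane), NOT Node 00's [B9] operator layer of record — **N15 is NOT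
discharged** by this file (the chair books, never the lane); K3⁸ OPEN, skeleton v7 untouched (its N15 pin `K3V5Defs.N15PinnedSized` still names S-B's U-blind `fullGSizedObjects`); counts
UNMOVED (typed 28∕28 · discharged 7∕28 = 7∕27 excl. NODE O); one finite 𝕋⁴ at fixed ε per index — NOT ℝ⁴ ∕ infinite volume ∕ OS ∕ mass gap ∕ Clay.  Three plumbing `def`s ⇒ review ∕
audit lane.  No `sorry`, `instance`, `notation`, `maxHeartbeats`; standard axioms.
-/

noncomputable section

open scoped BigOperators Matrix
open Finset

namespace Summit.QuantumFields.YangMills.BalabanUVNodes.N15.SiteLayerBg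

open Literature.MathematicalPhysics.QuantumFieldTheory.Balaban1983to89
open Literature.MathematicalPhysics.QuantumFieldTheory.Balaban1983to89.T4Continuum (T4Family ULoop)
open Literature.MathematicalPhysics.QuantumFieldTheory.Balaban1983to89.T4EtaRate (PairedInstance NE2PlusOperator NE2PlusSite NE2PlusUnit EtaRateIneqSite rateFactor)
open Literature.MathematicalPhysics.QuantumFieldTheory.Balaban1983to89.T4EtaRateDefect (rateWeight)
open Literature.MathematicalPhysics.QuantumFieldTheory.Balaban1983to89.T4EtaRateCoeffDefect (blockAvg fit_blockAvg)
open Literature.MathematicalPhysics.QuantumFieldTheory.Balaban1983to89.T4Cov2156Rate (kernelRate166)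
open Literature.MathematicalPhysics.QuantumFieldTheory.Balaban1983to89.B5Prop11Plancherel (Tor fine)
open Literature.MathematicalPhysics.QuantumFieldTheory.Balaban1983to89.B6Lemma24Torus (pbox)
open Literature.MathematicalPhysics.QuantumFieldTheory.Balaban1983to89.B6BondEliminationTorus (pdist)
open Literature.MathematicalPhysics.QuantumFieldTheory.Balaban1983to89.B6Cov2156Torus (deltaPol one_le_M)
open Literature.MathematicalPhysics.QuantumFieldTheory.Balaban1983to89.B6LowerBound2153Torus (rep rep_mem_pbox)
open Literature.MathematicalPhysics.QuantumFieldTheory.Balaban1983to89.B6UnitTorusCarrier (unitTorusGeo unitTorusGeo_len pdist_rep_rep)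
open Literature.MathematicalPhysics.QuantumFieldTheory.King1986 (exp_decay_mono)
open Literature.MathematicalPhysics.QuantumFieldTheory.King1986.Torus (tdistT tdistT_nonneg)
open Node00 (NE2Objects₁₁)
open Summit.QuantumFields.YangMills.BalabanUVNodes.N15.OperatorReadout (opGeo opGeo_len rateFactor_opGeo)
open Summit.QuantumFields.YangMills.BalabanUVNodes.N15.TwoGrid (gOp qvRe qvAdjRe TGIndex coeffBgFO reg335_coeffBgFO_iff foInstanceFG foInstanceFG_gf_M foFamilyAllFG
  ne2PlusOperator_allEntries_fullG osc_rate_le)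
open Summit.QuantumFields.YangMills.BalabanUVNodes.N15.VectorPiece (blkFine kingPrV bshiftEquiv unitTorusGeoS rateWeight_unitTorusGeoS)
open Summit.QuantumFields.YangMills.BalabanUVNodes.N15.BackgroundLayer (fgrad fgrad_apply fibreOsc_of_fgrad blockAvg_zero)
open Summit.QuantumFields.YangMills.BalabanUVNodes.N15.GenuineRecord (TGIndexS tgIndexS_cofinal live_foInstanceFG)
open Summit.QuantumFields.YangMills.BalabanUVNodes.N15.GenuineSite (etaRateIneqSite_opGeo_unit)
open Summit.QuantumFields.YangMills.BalabanUVNodes.N15.UnitLayerBg (e0Op zOp zOp_zero unitBondMat unitBondMat_zero sOp inv_unitBondMat_sOp exDress bgPertEx bgPertEx_zero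
  deltaPol_add_bgPertEx_eq_inv_symProp exDress_deltaPol_letters zOp_letters_FO foCovBg ne2PlusUnit_foCovBg dvd_Mn_S)
open Summit.QuantumFields.YangMills.BalabanUVNodes.N15.AtKeyedHome (s_N15_of_admits)
open Summit.QuantumFields.YangMills.BalabanUVNodes.N15.PairedFamilyGuard (Live)
open YMDAG.UVSplit (Datum NE2Carriers RateCarriers RateRecordPred N15At S_N15 ne2OfRecord₁₁)

variable {d : ℕ} {L : ℕ} [NeZero L]

/-! ## §1 The U-seeing site kernel: the exact-dressed effective operator, fine minus coarse -/

section Kernel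

variable (M : Fin (d + 1) → ℕ) [∀ μ, NeZero (M μ)] (n : ℕ) [NeZero n] (b : ℝ)

omit [NeZero L] in
/-- THE EXACT-DRESSED EFFECTIVE UNIT-LATTICE OPERATOR at fineness `n` and coefficient pair `U = (c, a_μ)`: `S^{(n)}(U) := b·1 + Δ^{(n)} + P_ex^{(n)}(U)` on the unit bonds —
`Δ^{(n)} = deltaPol M n` (the (1.66) matrix), `P_ex = exDress b Δ^{(n)} (unitBondMat Z^{(n)}(U))` (V-D `bgPertEx`). [cite: Balaban1984PropagatorsI, (1.65)–(1.66) p.29, (1.102)–(1.103) p.34 (objects)] -/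
def sitePolEx (c : Tor (fine n M) × Fin (d + 1) → ℝ) (a : Fin (d + 1) → Tor (fine n M) × Fin (d + 1) → ℝ) :
    Matrix (B4.Idx (pbox M) (d + 1)) (B4.Idx (pbox M) (d + 1)) ℝ :=
  b • (1 : Matrix (B4.Idx (pbox M) (d + 1)) (B4.Idx (pbox M) (d + 1)) ℝ) + deltaPol M n + bgPertEx M n b c a

omit [NeZero L] in
/-- ★★ **THE HONEST DICTIONARY — THE SITE OBJECT IS `(Q E₀ˢ(U) Q*)⁻¹`**: `S^{(n)}(U) = (unitBondMat (Q_n E₀ˢ(U) Q_n*))⁻¹`, `E₀ˢ = ½(E₀ + E₀ᵀ)` — Bałaban's map `E ↦ (QEQ*)⁻¹`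
((1.102)–(1.103)) VERBATIM at the operator layer's own dressed propagator, symmetrised (V-D `deltaPol_add_bgPertEx_eq_inv_symProp`); the [B9] (3.132)-type object `(QG(U)Q*)⁻¹` of the
site-kernel layer, model level. [cite: Balaban1984PropagatorsI, (1.102)–(1.103) p.34; Balaban1985BackgroundPropagators, (3.132) p.422 (object, shape)] -/
theorem sitePolEx_eq_inv_symProp (hn : 1 ≤ n) (hb : 0 < b) (c : Tor (fine n M) × Fin (d + 1) → ℝ) (a : Fin (d + 1) → Tor (fine n M) × Fin (d + 1) → ℝ) :
    sitePolEx M n b c a =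
      (unitBondMat M (qvRe M n ∘ₗ (((2 : ℝ)⁻¹ • (e0Op d M n b c a + Matrix.toLin' (LinearMap.toMatrix' (e0Op d M n b c a))ᵀ)) ∘ₗ qvAdjRe M n)))⁻¹ :=
  deltaPol_add_bgPertEx_eq_inv_symProp M n b hn hb c a

omit [NeZero L] in
/-- ★ **AT ZERO COEFFICIENTS THE SITE OBJECT IS `(Q G Q*)⁻¹ = b·1 + Δ^{(n)}`** — the (1.103) identity at `U ≡ 1` (V-A `inv_unitBondMat_sOp`, V-D `bgPertEx_zero`).
[cite: Balaban1984PropagatorsI, (1.102)–(1.103) p.34] -/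
theorem sitePolEx_zero (hn : 1 ≤ n) (hb : 0 < b) :
    sitePolEx M n b (fun _ => 0) (fun _ _ => 0) = (unitBondMat M (sOp M n b))⁻¹ := by
  unfold sitePolEx
  rw [bgPertEx_zero M n hn hb, add_zero, inv_unitBondMat_sOp M n hn hb]

omit [NeZero L] in
/-- The entries of the site object: `S(U)(p,q) = b·1(p,q) + Δ(p,q) + P_ex(U)(p,q)`. [folklore] -/
theorem sitePolEx_apply (c : Tor (fine n M) × Fin (d + 1) → ℝ) (a : Fin (d + 1) → Tor (fine n M) × Fin (d + 1) → ℝ) (p q : B4.Idx (pbox M) (d + 1)) :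
    sitePolEx M n b c a p q = b * (1 : Matrix (B4.Idx (pbox M) (d + 1)) (B4.Idx (pbox M) (d + 1)) ℝ) p q + deltaPol M n p q + bgPertEx M n b c a p q := by
  simp only [sitePolEx, Matrix.add_apply, Matrix.smul_apply, smul_eq_mul]

end Kernel

section SiteKernel

/-- ★ **THE U-SEEING SITE-LAYER η-DIFFERENCE KERNEL** on `foInstanceFG d hL j`: `(U, y, y′) ↦ S^{(L^mL^k)}(U)((ȳ,α),(ȳ′,β)) − S^{(L^k)}(Ū)((ȳ,α),(ȳ′,β))` — the fine run's
exact-dressed effective operator `(Q′E₀ˢ′(U)Q′*)⁻¹` AT `U = (c′, a′)` minus the coarse run's `(QĒ₀ˢ(Ū)Q*)⁻¹` AT THE BLOCK-AVERAGED COARSE PARTNER `Ū = (blockAvg c′, blockAvg a′_μ)`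
(the pairing's `avg`), read at the unit bonds of directions `α, β` based at the box representatives. [cite: Balaban1985BackgroundPropagators, (3.132) p.422 (object `(QG(U)Q*)⁻¹`, shape);
Balaban1984PropagatorsI, (1.102)–(1.103) p.34 (the map at `U ≡ 1`)] -/
def foSiteBg (d : ℕ) (hL : Odd L ∧ 1 < L) (b : ℝ) (α β : Fin (d + 1)) (j : TGIndexS) : B9.SiteKernel (foInstanceFG d hL j).gc (foInstanceFG d hL j).Bf :=
  ⟨fun U y y' =>
    sitePolEx (TGIndex.Mn d hL j.toTGIndex) (L ^ j.m * L ^ j.k) b U.1 U.2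
        (⟨rep (TGIndex.Mn d hL j.toTGIndex) y, rep_mem_pbox (TGIndex.Mn d hL j.toTGIndex) y⟩, α)
        (⟨rep (TGIndex.Mn d hL j.toTGIndex) y', rep_mem_pbox (TGIndex.Mn d hL j.toTGIndex) y'⟩, β)
      - sitePolEx (TGIndex.Mn d hL j.toTGIndex) (L ^ j.k) b (blockAvg (kingPrV L j.k j.m (TGIndex.Mn d hL j.toTGIndex)) U.1)
          (fun μ => blockAvg (kingPrV L j.k j.m (TGIndex.Mn d hL j.toTGIndex)) (U.2 μ))
        (⟨rep (TGIndex.Mn d hL j.toTGIndex) y, rep_mem_pbox (TGIndex.Mn d hL j.toTGIndex) y⟩, α)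
        (⟨rep (TGIndex.Mn d hL j.toTGIndex) y', rep_mem_pbox (TGIndex.Mn d hL j.toTGIndex) y'⟩, β)⟩

/-- Unfolding of `foSiteBg`. [folklore] -/
theorem foSiteBg_ker (hL : Odd L ∧ 1 < L) (b : ℝ) (α β : Fin (d + 1)) (j : TGIndexS) (U : (foInstanceFG d hL j).Bf.Cfg) (y y' : Tor (TGIndex.Mn d hL j.toTGIndex)) :
    (foSiteBg d hL b α β j).ker U y y' =
      sitePolEx (TGIndex.Mn d hL j.toTGIndex) (L ^ j.m * L ^ j.k) b U.1 U.2
          (⟨rep (TGIndex.Mn d hL j.toTGIndex) y, rep_mem_pbox (TGIndex.Mn d hL j.toTGIndex) y⟩, α)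
          (⟨rep (TGIndex.Mn d hL j.toTGIndex) y', rep_mem_pbox (TGIndex.Mn d hL j.toTGIndex) y'⟩, β)
        - sitePolEx (TGIndex.Mn d hL j.toTGIndex) (L ^ j.k) b (blockAvg (kingPrV L j.k j.m (TGIndex.Mn d hL j.toTGIndex)) U.1)
            (fun μ => blockAvg (kingPrV L j.k j.m (TGIndex.Mn d hL j.toTGIndex)) (U.2 μ))
          (⟨rep (TGIndex.Mn d hL j.toTGIndex) y, rep_mem_pbox (TGIndex.Mn d hL j.toTGIndex) y⟩, α)
          (⟨rep (TGIndex.Mn d hL j.toTGIndex) y', rep_mem_pbox (TGIndex.Mn d hL j.toTGIndex) y'⟩, β) := rfl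

/-- ★ **AT `U = 0` THE U-SEEING SITE KERNEL IS KING's (1.66) η-DIFFERENCE** `Δ^{(L^{k+m})} − Δ^{(L^k)}` at the bonds: the carrier's `one` is the zero coefficient pair, whose block
averages vanish; both exact perturbations vanish and the `b·1` cancel (`b > 0`). [cite: Balaban1984PropagatorsI, (1.66) p.29 (object); King1986, Lemma 4.5 (4.38) p.674 (shape)] -/
theorem foSiteBg_one (hL : Odd L ∧ 1 < L) {b : ℝ} (hb : 0 < b) (α β : Fin (d + 1)) (j : TGIndexS) (y y' : Tor (TGIndex.Mn d hL j.toTGIndex)) :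
    (foSiteBg d hL b α β j).ker (foInstanceFG d hL j).Bf.one y y' =
      deltaPol (TGIndex.Mn d hL j.toTGIndex) (L ^ (j.k + j.m)) (⟨rep (TGIndex.Mn d hL j.toTGIndex) y, rep_mem_pbox (TGIndex.Mn d hL j.toTGIndex) y⟩, α)
          (⟨rep (TGIndex.Mn d hL j.toTGIndex) y', rep_mem_pbox (TGIndex.Mn d hL j.toTGIndex) y'⟩, β)
        - deltaPol (TGIndex.Mn d hL j.toTGIndex) (L ^ j.k) (⟨rep (TGIndex.Mn d hL j.toTGIndex) y, rep_mem_pbox (TGIndex.Mn d hL j.toTGIndex) y⟩, α)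
          (⟨rep (TGIndex.Mn d hL j.toTGIndex) y', rep_mem_pbox (TGIndex.Mn d hL j.toTGIndex) y'⟩, β) := by
  have hL1 : 1 ≤ L := by have := hL.2; omega
  have hLk : 1 ≤ L ^ j.k := Nat.one_le_pow _ _ hL1
  have hLmk : 1 ≤ L ^ j.m * L ^ j.k := Nat.one_le_iff_ne_zero.mpr (Nat.mul_ne_zero (by have := Nat.one_le_pow j.m L hL1; omega) (by omega))
  have h1 : (foInstanceFG d hL j).Bf.one = ((fun _ => 0, fun _ _ => 0) : (Tor (fine (L ^ j.m * L ^ j.k) (TGIndex.Mn d hL j.toTGIndex)) × Fin (d + 1) → ℝ) ×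
      (Fin (d + 1) → Tor (fine (L ^ j.m * L ^ j.k) (TGIndex.Mn d hL j.toTGIndex)) × Fin (d + 1) → ℝ)) := rfl
  have hc0 : blockAvg (kingPrV L j.k j.m (TGIndex.Mn d hL j.toTGIndex)) (fun _ : Tor (fine (L ^ j.m * L ^ j.k) (TGIndex.Mn d hL j.toTGIndex)) × Fin (d + 1) => (0 : ℝ))
      = fun _ => 0 := blockAvg_zero (kingPrV L j.k j.m (TGIndex.Mn d hL j.toTGIndex))
  rw [foSiteBg_ker, h1]
  show sitePolEx (TGIndex.Mn d hL j.toTGIndex) (L ^ j.m * L ^ j.k) b (fun _ => 0) (fun _ _ => 0) _ _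
      - sitePolEx (TGIndex.Mn d hL j.toTGIndex) (L ^ j.k) b (blockAvg (kingPrV L j.k j.m (TGIndex.Mn d hL j.toTGIndex)) (fun _ => 0))
          (fun μ => blockAvg (kingPrV L j.k j.m (TGIndex.Mn d hL j.toTGIndex)) (fun _ => 0)) _ _ = _
  rw [hc0]
  unfold sitePolEx
  rw [bgPertEx_zero _ _ hLmk hb, bgPertEx_zero _ _ hLk hb, add_zero, add_zero, show L ^ j.m * L ^ j.k = L ^ (j.k + j.m) by rw [pow_add, mul_comm],
    Matrix.add_apply, Matrix.add_apply]
  ring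

end SiteKernel

/-! ## §2 ★★★ `NE2PlusSite` by name with the background live, size live -/

section SiteLayer

variable (d)

/-- ★★★ **`NE2PlusSite` — THE NODE's SECOND CONJUNCT BY NAME — WITH THE BACKGROUND LIVE AND THE SIZE LIVE**, on II-E's sized (3.35)-pair family: for `d ≥ 1`, odd `L ≥ 3`, `b > 0`,
`c₃₅ > 0`, every direction pair `α β` and every exponent pair `(d′, p)`, `NE2PlusSite d′ p c₃₅ (foInstanceFG d hL) (foSiteBg d hL b α β)` — constants `(M₅, δ, a₀, C, γ₀)` after
`d, L, b, c₃₅`, `γ₀ = min(1∕16, 1∕(8(d+1)))`, `a₀ = min(r₁, ζ₀∕ζ)∕c₃₅`.  The kernel READS `U` (`P_ex′(U)` fine, `P_ex(Ū)` coarse); the guard `M·α₀ ≤ a₀` is LIVE (`(gf j).M = M_sz`)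
and the (3.35) letters read `c₃₅·M_sz·α₀`; the threshold is a smallness of `M·α₀` ALONE (V-C's finite Combes–Thomas margin `ζ₀` and Λ-E's window `r₁`); at unit sites the
`(L^jη)^{−p}(L^{j′}η)^{−d′}` prefactors are `1` and the rate factor is `(L^k)^{−γ₀}` (G1 `etaRateIneqSite_opGeo_unit`).  Chain: Λ-E `zOp_letters_FO` → V-C `exDress_deltaPol_letters` +
`kernelRate166`.  NO Neumann series, NO weight window. [cite: Balaban1985BackgroundPropagators, Thm 3.2 (3.48) p.398 + (3.132) p.422 + Thm 3.14 pp.426–427 (quantifier template,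
shapes), (3.35) p.396; Balaban1984PropagatorsI, (1.66) p.29, (1.102)–(1.103) p.34 (objects); King1986, Lemma 4.5 (4.38)–(4.41) pp.674–675 (shape, mechanism); CombesThomas1973, §II (mechanism)] -/
theorem ne2PlusSite_foSiteBg (hd : 1 ≤ d) (hLodd : Odd L) (hL3 : 3 ≤ L) (hL : Odd L ∧ 1 < L) {b : ℝ} (hb : 0 < b) {c35 : ℝ} (hc35 : 0 < c35) (α β : Fin (d + 1))
    (d' : ℕ) (p : ℝ) :
    NE2PlusSite d' p c35 (foInstanceFG d hL) (foSiteBg d hL b α β) := by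
  have hL2 : 2 ≤ L := by omega
  have hL1 : 1 ≤ L := by omega
  have hL1r : (1 : ℝ) ≤ (L : ℝ) := by exact_mod_cast hL1
  have hL0r : (0 : ℝ) < (L : ℝ) := by positivity
  have hd0 : (0 : ℝ) ≤ d := Nat.cast_nonneg d
  obtain ⟨δZ, ζ, τ, r₁, hδZ, hζ, hτ, hr₁, HZ⟩ := zOp_letters_FO d hLodd hL3 hL hb
  obtain ⟨K, δ', ζ₀, hK, hδ', hζ₀, HP⟩ := exDress_deltaPol_letters (d + 1) (by omega) hb hδZ
  obtain ⟨θ₀, δ₁, hθ₀, hδ₁, HΔ⟩ := kernelRate166 (d := d + 1) (by omega)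
  -- the rate exponent, the threshold and the constants
  set γ₀ : ℝ := min (1 / 16) (1 / (8 * ((d : ℝ) + 1))) with hγ₀def
  have hd8 : (0 : ℝ) < 1 / (8 * ((d : ℝ) + 1)) := by positivity
  have hγ₀ : 0 < γ₀ := lt_min (by norm_num) hd8
  have hγ₀le : γ₀ ≤ 1 / 16 := min_le_left _ _
  have hγ₀le' : γ₀ ≤ 1 / (8 * ((d : ℝ) + 1)) := min_le_right _ _
  set a₀ : ℝ := min (r₁ / c35) (ζ₀ / (ζ * c35)) with ha₀def
  have ha₀ : 0 < a₀ := lt_min (div_pos hr₁ hc35) (div_pos hζ₀ (by positivity))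
  set rmax : ℝ := c35 * a₀ with hrmax_def
  have hrmax : 0 ≤ rmax := by positivity
  have hrmax₁ : rmax ≤ r₁ := by
    have h := mul_le_mul_of_nonneg_left (min_le_left (r₁ / c35) (ζ₀ / (ζ * c35))) hc35.le
    rwa [mul_div_cancel₀ _ hc35.ne'] at h
  have hrmaxζ : ζ * rmax ≤ ζ₀ := by
    have h := mul_le_mul_of_nonneg_left (min_le_right (r₁ / c35) (ζ₀ / (ζ * c35))) (le_of_lt (mul_pos hζ hc35))
    calc ζ * rmax = ζ * c35 * a₀ := by rw [hrmax_def]; ring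
      _ ≤ ζ * c35 * (ζ₀ / (ζ * c35)) := h
      _ = ζ₀ := mul_div_cancel₀ _ (by positivity)
  set cT : ℝ := 1 + rmax + 2 * ((d : ℝ) + 1) * rmax with hcT_def
  have hcT : 0 ≤ cT := by positivity
  set δ'' : ℝ := min δ₁ δ' with hδ''def
  have hδ'' : 0 < δ'' := lt_min hδ₁ hδ'
  refine ⟨1, δ'', a₀, θ₀ + K * (τ * cT + 1) + 1, γ₀, one_pos, hδ'', ha₀, by positivity, hγ₀, fun j _ α₀ hα₀ hMα U hU => ?_⟩
  -- the index data and the letters of the configuration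
  rw [foInstanceFG_gf_M] at hMα
  obtain ⟨hU1, hU2, hU3⟩ := (reg335_coeffBgFO_iff (TGIndex.Mn d hL j.toTGIndex) (L ^ j.m * L ^ j.k) j.Msz c35 α₀ U).1 hU
  have hMsz : (0 : ℝ) ≤ j.Msz := zero_le_one.trans j.one_le_Msz
  have hr0 : 0 ≤ c35 * j.Msz * α₀ := by positivity
  have hrrmax : c35 * j.Msz * α₀ ≤ rmax := by
    rw [hrmax_def, mul_assoc]; exact mul_le_mul_of_nonneg_left hMα hc35.le
  have hrr₁ : c35 * j.Msz * α₀ ≤ r₁ := hrrmax.trans hrmax₁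
  have hLk : 1 ≤ L ^ j.k := Nat.one_le_pow _ _ hL1
  have hLm : 1 ≤ L ^ j.m := Nat.one_le_pow _ _ hL1
  have hLkr : (0 : ℝ) < (L : ℝ) ^ j.k := by positivity
  have hn' : (0 : ℝ) < ((L ^ j.m * L ^ j.k : ℕ) : ℝ) := by positivity
  have hcast : ((L ^ j.k : ℕ) : ℝ) = (L : ℝ) ^ j.k := by push_cast; ring
  have hx1 : (1 : ℝ) ≤ (L : ℝ) ^ j.k := one_le_pow₀ hL1r
  -- the derived fit of `a′`
  have hfa : ∀ μ' z, |U.2 μ' z - blockAvg (kingPrV L j.k j.m (TGIndex.Mn d hL j.toTGIndex)) (U.2 μ') (kingPrV L j.k j.m (TGIndex.Mn d hL j.toTGIndex) z)| ≤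
      ((2 * ((d + 1) * (L ^ j.m - 1)) : ℕ) : ℝ) * (c35 * j.Msz * α₀ / ((L ^ j.m * L ^ j.k : ℕ) : ℝ)) :=
    fun μ' z => fit_blockAvg _ (fibreOsc_of_fgrad L j.k j.m (TGIndex.Mn d hL j.toTGIndex) hn' fun κ' z => hU3 μ' κ' z) z
  have hoa : 0 ≤ ((2 * ((d + 1) * (L ^ j.m - 1)) : ℕ) : ℝ) * (c35 * j.Msz * α₀ / ((L ^ j.m * L ^ j.k : ℕ) : ℝ)) := by positivity
  -- the rate atoms: `t = (L^k)^{−γ₀}` dominates `(L^k)^{−1∕16}`, `(L^k)^{−1∕(8(d+1))}`, `(L^k)⁻¹` and the fit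
  set t : ℝ := ((L : ℝ) ^ j.k) ^ (-γ₀) with ht_def
  have ht0 : 0 ≤ t := Real.rpow_nonneg hLkr.le _
  have h16 : ((L ^ j.k : ℕ) : ℝ) ^ (-(1 / 16 : ℝ)) ≤ t := by rw [hcast]; exact Real.rpow_le_rpow_of_exponent_le hx1 (by linarith)
  have h8 : ((L ^ j.k : ℕ) : ℝ) ^ (-(1 / (8 * ((d : ℝ) + 1)))) ≤ t := by rw [hcast]; exact Real.rpow_le_rpow_of_exponent_le hx1 (by linarith)
  have htinv : (((L ^ j.k : ℕ) : ℝ))⁻¹ ≤ t := by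
    rw [hcast, ← Real.rpow_neg_one]; exact Real.rpow_le_rpow_of_exponent_le hx1 (by linarith)
  have hn0 : 0 ≤ (((L ^ j.k : ℕ) : ℝ))⁻¹ := by positivity
  have hosc := osc_rate_le (d := d) j.k j.m hL1r (γ := γ₀) hr0 hrrmax (by linarith)
  obtain ⟨T, hT⟩ : ∃ x : ℝ, x = ((L ^ j.k : ℕ) : ℝ) ^ (-(1 / 16 : ℝ)) + c35 * j.Msz * α₀ * ((L ^ j.k : ℕ) : ℝ) ^ (-(1 / (8 * ((d : ℝ) + 1)))) +
      ((2 * ((d + 1) * (L ^ j.m - 1)) : ℕ) : ℝ) * (c35 * j.Msz * α₀ / ((L ^ j.m * L ^ j.k : ℕ) : ℝ)) := ⟨_, rfl⟩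
  have hT0 : 0 ≤ T := hT ▸ by positivity
  have hTle : T ≤ cT * t := by
    have hmid : c35 * j.Msz * α₀ * ((L ^ j.k : ℕ) : ℝ) ^ (-(1 / (8 * ((d : ℝ) + 1)))) ≤ rmax * t := mul_le_mul hrrmax h8 (Real.rpow_nonneg (by positivity) _) hrmax
    rw [hT, hcT_def]
    have e : (1 + rmax + 2 * ((d : ℝ) + 1) * rmax) * t = t + rmax * t + 2 * ((d : ℝ) + 1) * rmax * t := by ring
    rw [e]
    linarith [hosc, hmid, h16]
  -- Λ-E: the middle factor's letters
  obtain ⟨hZ1, hZ2, hZ3⟩ := HZ j.toTGIndex (c35 * j.Msz * α₀) hr0 hrr₁ _ hoa U.1 U.2 hU1 hU2 hfa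
  rw [← hT] at hZ3
  have hζr : 0 ≤ ζ * (c35 * j.Msz * α₀) := by positivity
  have hζrζ₀ : ζ * (c35 * j.Msz * α₀) ≤ ζ₀ := (mul_le_mul_of_nonneg_left hrrmax hζ.le).trans hrmaxζ
  have hτT : 0 ≤ τ * T := by positivity
  -- V-C: the exact perturbation letters (only (iii) is used)
  obtain ⟨-, -, -, -, hP12⟩ := HP (TGIndex.Mn d hL j.toTGIndex) (L ^ j.k) (L ^ j.m * L ^ j.k) (L ^ j.m) hLk hLm rfl
    (unitBondMat (TGIndex.Mn d hL j.toTGIndex) (zOp d (TGIndex.Mn d hL j.toTGIndex) (L ^ j.k) b (blockAvg (kingPrV L j.k j.m (TGIndex.Mn d hL j.toTGIndex)) U.1)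
      (fun μ => blockAvg (kingPrV L j.k j.m (TGIndex.Mn d hL j.toTGIndex)) (U.2 μ))))
    (unitBondMat (TGIndex.Mn d hL j.toTGIndex) (zOp d (TGIndex.Mn d hL j.toTGIndex) (L ^ j.m * L ^ j.k) b U.1 U.2))
    (ζ * (c35 * j.Msz * α₀)) (τ * T) hζr hζrζ₀ hτT hZ1 hZ2 hZ3
  -- King: the (1.66) η-difference letter
  have hΔ := HΔ (TGIndex.Mn d hL j.toTGIndex) (L ^ j.k) (L ^ j.m * L ^ j.k) (L ^ j.m) hLk hLm rfl
  -- the readout at unit sites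
  have hη : (unitTorusGeoS L j.k (TGIndex.Mn d hL j.toTGIndex) j.Msz).eta ≠ 0 := inv_ne_zero (pow_ne_zero _ hL0r.ne')
  refine etaRateIneqSite_opGeo_unit (g := unitTorusGeoS L j.k (TGIndex.Mn d hL j.toTGIndex) j.Msz) (foSiteBg d hL b α β j)
    (unitTorusGeo_len L j.k (TGIndex.Mn d hL j.toTGIndex) (NeZero.ne L)) hη hL0r (fun y y' => ?_) d' p
  rw [rateWeight_unitTorusGeoS, rateWeight_unitTorusGeoS, max_self]
  have hdist : pdist (TGIndex.Mn d hL j.toTGIndex) (one_le_M (TGIndex.Mn d hL j.toTGIndex)) (rep (TGIndex.Mn d hL j.toTGIndex) y) (rep (TGIndex.Mn d hL j.toTGIndex) y')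
      = tdistT (TGIndex.Mn d hL j.toTGIndex) y y' := pdist_rep_rep _ _ y y'
  have hρ0 : 0 ≤ pdist (TGIndex.Mn d hL j.toTGIndex) (one_le_M (TGIndex.Mn d hL j.toTGIndex)) (rep (TGIndex.Mn d hL j.toTGIndex) y) (rep (TGIndex.Mn d hL j.toTGIndex) y') := by
    rw [hdist]; exact tdistT_nonneg _ y y'
  -- the two letters at the output rate δ''
  have hθn : 0 ≤ θ₀ * ((L ^ j.k : ℕ) : ℝ)⁻¹ := by positivity
  have hKn : 0 ≤ K * (τ * T + ((L ^ j.k : ℕ) : ℝ)⁻¹) := by positivity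
  have hA : |deltaPol (TGIndex.Mn d hL j.toTGIndex) (L ^ j.m * L ^ j.k)
          (⟨rep (TGIndex.Mn d hL j.toTGIndex) y, rep_mem_pbox (TGIndex.Mn d hL j.toTGIndex) y⟩, α) (⟨rep (TGIndex.Mn d hL j.toTGIndex) y', rep_mem_pbox (TGIndex.Mn d hL j.toTGIndex) y'⟩, β)
        - deltaPol (TGIndex.Mn d hL j.toTGIndex) (L ^ j.k)
          (⟨rep (TGIndex.Mn d hL j.toTGIndex) y, rep_mem_pbox (TGIndex.Mn d hL j.toTGIndex) y⟩, α) (⟨rep (TGIndex.Mn d hL j.toTGIndex) y', rep_mem_pbox (TGIndex.Mn d hL j.toTGIndex) y'⟩, β)|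
      ≤ θ₀ * ((L ^ j.k : ℕ) : ℝ)⁻¹ *
        Real.exp (-(δ'' * pdist (TGIndex.Mn d hL j.toTGIndex) (one_le_M (TGIndex.Mn d hL j.toTGIndex)) (rep (TGIndex.Mn d hL j.toTGIndex) y) (rep (TGIndex.Mn d hL j.toTGIndex) y'))) :=
    (hΔ _ _).trans (exp_decay_mono hθn (min_le_left _ _) hρ0)
  have hB : |bgPertEx (TGIndex.Mn d hL j.toTGIndex) (L ^ j.m * L ^ j.k) b U.1 U.2
          (⟨rep (TGIndex.Mn d hL j.toTGIndex) y, rep_mem_pbox (TGIndex.Mn d hL j.toTGIndex) y⟩, α) (⟨rep (TGIndex.Mn d hL j.toTGIndex) y', rep_mem_pbox (TGIndex.Mn d hL j.toTGIndex) y'⟩, β)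
        - bgPertEx (TGIndex.Mn d hL j.toTGIndex) (L ^ j.k) b (blockAvg (kingPrV L j.k j.m (TGIndex.Mn d hL j.toTGIndex)) U.1)
            (fun μ => blockAvg (kingPrV L j.k j.m (TGIndex.Mn d hL j.toTGIndex)) (U.2 μ))
          (⟨rep (TGIndex.Mn d hL j.toTGIndex) y, rep_mem_pbox (TGIndex.Mn d hL j.toTGIndex) y⟩, α) (⟨rep (TGIndex.Mn d hL j.toTGIndex) y', rep_mem_pbox (TGIndex.Mn d hL j.toTGIndex) y'⟩, β)|
      ≤ K * (τ * T + ((L ^ j.k : ℕ) : ℝ)⁻¹) *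
        Real.exp (-(δ'' * pdist (TGIndex.Mn d hL j.toTGIndex) (one_le_M (TGIndex.Mn d hL j.toTGIndex)) (rep (TGIndex.Mn d hL j.toTGIndex) y) (rep (TGIndex.Mn d hL j.toTGIndex) y'))) :=
    (hP12 _ _).trans (exp_decay_mono hKn (min_le_right _ _) hρ0)
  have hE := Real.exp_nonneg (-(δ'' * pdist (TGIndex.Mn d hL j.toTGIndex) (one_le_M (TGIndex.Mn d hL j.toTGIndex)) (rep (TGIndex.Mn d hL j.toTGIndex) y) (rep (TGIndex.Mn d hL j.toTGIndex) y')))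
  -- the amplitude against `t`
  have hamp : θ₀ * ((L ^ j.k : ℕ) : ℝ)⁻¹ + K * (τ * T + ((L ^ j.k : ℕ) : ℝ)⁻¹) ≤ (θ₀ + K * (τ * cT + 1) + 1) * t := by
    have h1 : θ₀ * ((L ^ j.k : ℕ) : ℝ)⁻¹ ≤ θ₀ * t := mul_le_mul_of_nonneg_left htinv hθ₀.le
    have h2 : τ * T ≤ τ * cT * t := by rw [mul_assoc]; exact mul_le_mul_of_nonneg_left hTle hτ.le
    have h3 : K * (τ * T + ((L ^ j.k : ℕ) : ℝ)⁻¹) ≤ K * (τ * cT + 1) * t := by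
      calc K * (τ * T + ((L ^ j.k : ℕ) : ℝ)⁻¹) ≤ K * (τ * cT * t + t) := mul_le_mul_of_nonneg_left (add_le_add h2 htinv) hK.le
        _ = K * (τ * cT + 1) * t := by ring
    calc θ₀ * ((L ^ j.k : ℕ) : ℝ)⁻¹ + K * (τ * T + ((L ^ j.k : ℕ) : ℝ)⁻¹) ≤ θ₀ * t + K * (τ * cT + 1) * t := add_le_add h1 h3
      _ = (θ₀ + K * (τ * cT + 1)) * t := by ring
      _ ≤ _ := mul_le_mul_of_nonneg_right (by linarith) ht0
  -- the kernel is the sum of the two letters (the `b·1` cancel)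
  rw [foSiteBg_ker, sitePolEx_apply, sitePolEx_apply,
    show (unitTorusGeoS L j.k (TGIndex.Mn d hL j.toTGIndex) j.Msz).dist y y' = tdistT (TGIndex.Mn d hL j.toTGIndex) y y' from rfl, ← hdist]
  calc _ ≤ θ₀ * ((L ^ j.k : ℕ) : ℝ)⁻¹ *
          Real.exp (-(δ'' * pdist (TGIndex.Mn d hL j.toTGIndex) (one_le_M (TGIndex.Mn d hL j.toTGIndex)) (rep (TGIndex.Mn d hL j.toTGIndex) y) (rep (TGIndex.Mn d hL j.toTGIndex) y')))
        + K * (τ * T + ((L ^ j.k : ℕ) : ℝ)⁻¹) *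
          Real.exp (-(δ'' * pdist (TGIndex.Mn d hL j.toTGIndex) (one_le_M (TGIndex.Mn d hL j.toTGIndex)) (rep (TGIndex.Mn d hL j.toTGIndex) y) (rep (TGIndex.Mn d hL j.toTGIndex) y'))) := by
        refine (le_of_eq (congrArg abs ?_)).trans ((abs_add_le _ _).trans (add_le_add hA hB))
        ring
    _ = (θ₀ * ((L ^ j.k : ℕ) : ℝ)⁻¹ + K * (τ * T + ((L ^ j.k : ℕ) : ℝ)⁻¹)) *
          Real.exp (-(δ'' * pdist (TGIndex.Mn d hL j.toTGIndex) (one_le_M (TGIndex.Mn d hL j.toTGIndex)) (rep (TGIndex.Mn d hL j.toTGIndex) y) (rep (TGIndex.Mn d hL j.toTGIndex) y'))) := by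
        ring
    _ ≤ ((θ₀ + K * (τ * cT + 1) + 1) * t) *
          Real.exp (-(δ'' * pdist (TGIndex.Mn d hL j.toTGIndex) (one_le_M (TGIndex.Mn d hL j.toTGIndex)) (rep (TGIndex.Mn d hL j.toTGIndex) y) (rep (TGIndex.Mn d hL j.toTGIndex) y'))) :=
        mul_le_mul_of_nonneg_right hamp hE
    _ = _ := by rw [ht_def]; ring

end SiteLayer

/-! ## §3 `N15At` with ALL THREE layers reading `U`; the guard; the `NE2Objects₁₁` literal; keyed face -/

section Record

/-- ★★★ **`N15At` — ALL THREE CONJUNCTS BY NAME FOR THE PAIR OF RECORD, EVERY LAYER READING THE BACKGROUND** (`d ≥ 1`, odd `L ≥ 3`, `b, c₃₅ > 0`; every `p`, directions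
`ν κ α β α′ β′`): OPERATOR = Λ-C `ne2PlusOperator_allEntries_fullG` (all four (3.42) entries), SITE = §2 `ne2PlusSite_foSiteBg` (`(QE₀ˢ(U)Q*)⁻¹`, exact inverse), UNIT = Λ-F
`ne2PlusUnit_foCovBg` (the dressed (2.156) covariance). NO U-blind layer is left on this family. [bookkeeping] -/
theorem n15At_allLayersBg (hd : 1 ≤ d) (hLodd : Odd L) (hL3 : 3 ≤ L) (hL : Odd L ∧ 1 < L) {b c35 : ℝ} (hb : 0 < b) (hc35 : 0 < c35)
    (ν κ α β α' β' : Fin (d + 1)) (p : ℝ) :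
    N15At { I := TGIndexS, c35 := c35, p := p, pi := foInstanceFG d hL, Kop := foFamilyAllFG d hL b ν κ,
            Ksite := foSiteBg d hL b α β, Kunit := foCovBg d hL b α' β', inΛ := fun _ _ => True, unitDist := fun j => (foInstanceFG d hL j).gc.dist } :=
  ⟨ne2PlusOperator_allEntries_fullG d hLodd hL3 hL hb c35 hc35 ν κ, ne2PlusSite_foSiteBg d hd hLodd hL3 hL hb hc35 α β 4 p,
    ne2PlusUnit_foCovBg d hd hLodd hL3 hL hb hc35 α' β'⟩

/-- ★★ **THE FAMILY WITH THESE KERNELS PASSES THE K3⁷∕K3⁸ GUARD** (Λ-D `live_foInstanceFG`: size and scale count jointly cofinal, the trivial field regular; `c₃₅ ≥ 0`). [bookkeeping] -/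
theorem live_allLayersBg (hL : Odd L ∧ 1 < L) {b c35 : ℝ} (hc35 : 0 ≤ c35) (ν κ α β α' β' : Fin (d + 1)) (p : ℝ) :
    Live ⟨TGIndexS, c35, p, foInstanceFG d hL, foFamilyAllFG d hL b ν κ, foSiteBg d hL b α β, foCovBg d hL b α' β', fun _ _ => True,
        fun j => (foInstanceFG d hL j).gc.dist⟩ :=
  live_foInstanceFG hL hc35 p _ _ _

/-- ★★★ **GUARD ∧ `N15At` FOR THE PAIR OF RECORD WITH EVERY LAYER READING `U`** (`d ≥ 1`, odd `L ≥ 3`, `b, c₃₅ > 0`). [bookkeeping] -/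
theorem live_and_n15At_allLayersBg (hd : 1 ≤ d) (hLodd : Odd L) (hL3 : 3 ≤ L) (hL : Odd L ∧ 1 < L) {b c35 : ℝ} (hb : 0 < b) (hc35 : 0 < c35)
    (ν κ α β α' β' : Fin (d + 1)) (p : ℝ) :
    Live ⟨TGIndexS, c35, p, foInstanceFG d hL, foFamilyAllFG d hL b ν κ, foSiteBg d hL b α β, foCovBg d hL b α' β', fun _ _ => True,
        fun j => (foInstanceFG d hL j).gc.dist⟩ ∧
      N15At { I := TGIndexS, c35 := c35, p := p, pi := foInstanceFG d hL, Kop := foFamilyAllFG d hL b ν κ,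
              Ksite := foSiteBg d hL b α β, Kunit := foCovBg d hL b α' β', inΛ := fun _ _ => True, unitDist := fun j => (foInstanceFG d hL j).gc.dist } :=
  ⟨live_allLayersBg hL hc35.le ν κ α β α' β' p, n15At_allLayersBg hd hLodd hL3 hL hb hc35 ν κ α β α' β' p⟩

/-- THE PAIR-OF-RECORD FAMILY WITH ALL THREE LAYERS U-SEEING, AS RR-1's NE2 OBJECT LITERAL (`NE2Objects₁₁`), field for field. [bookkeeping] -/
def allLayersBgObjects (d : ℕ) (hL : Odd L ∧ 1 < L) (b : ℝ) (ν κ α β α' β' : Fin (d + 1)) (c35 p : ℝ) : NE2Objects₁₁ :=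
  ⟨TGIndexS, c35, p, foInstanceFG d hL, foFamilyAllFG d hL b ν κ, foSiteBg d hL b α β, foCovBg d hL b α' β', fun _ _ => True, fun j => (foInstanceFG d hL j).gc.dist⟩

/-- the record map reads the literal as the rates bundle (`rfl`). [bookkeeping] -/
theorem ne2OfRecord₁₁_allLayersBgObjects (hL : Odd L ∧ 1 < L) (b : ℝ) (ν κ α β α' β' : Fin (d + 1)) (c35 p : ℝ) :
    ne2OfRecord₁₁ (allLayersBgObjects d hL b ν κ α β α' β' c35 p) =
      { I := TGIndexS, c35 := c35, p := p, pi := foInstanceFG d hL, Kop := foFamilyAllFG d hL b ν κ,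
        Ksite := foSiteBg d hL b α β, Kunit := foCovBg d hL b α' β', inΛ := fun _ _ => True, unitDist := fun j => (foInstanceFG d hL j).gc.dist } := rfl

/-- ★★ `N15At` at the literal (`d ≥ 1`, odd `L ≥ 3`, `b, c₃₅ > 0`). [bookkeeping] -/
theorem n15At_allLayersBgObjects (hd : 1 ≤ d) (hLodd : Odd L) (hL3 : 3 ≤ L) (hL : Odd L ∧ 1 < L) {b c35 : ℝ} (hb : 0 < b) (hc35 : 0 < c35)
    (ν κ α β α' β' : Fin (d + 1)) (p : ℝ) :
    N15At (ne2OfRecord₁₁ (allLayersBgObjects d hL b ν κ α β α' β' c35 p)) :=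
  n15At_allLayersBg hd hLodd hL3 hL hb hc35 ν κ α β α' β' p

/-- ★★ the literal is LIVE (`c₃₅ ≥ 0`). [bookkeeping] -/
theorem live_allLayersBgObjects (hL : Odd L ∧ 1 < L) (b : ℝ) (ν κ α β α' β' : Fin (d + 1)) {c35 : ℝ} (hc35 : 0 ≤ c35) (p : ℝ) :
    Live (ne2OfRecord₁₁ (allLayersBgObjects d hL b ν κ α β α' β' c35 p)) :=
  live_allLayersBg hL hc35 ν κ α β α' β' p

variable {N : ℕ} [NeZero N] {key : (F : T4Family) → Datum F N → Prop}

/-- ★★ **THE FAMILY AT ANY KEYED HOME** (part 30's interface): a rate home over ANY key admitting only the literals of a key-indexed NE2 reading whose value everywhere is this family has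
`S_N15 RRec` (`d ≥ 1`, odd `L ≥ 3`, `b, c₃₅ > 0`). [bookkeeping] -/
theorem s_N15_of_admits_allLayersBg (hd : 1 ≤ d) (hLodd : Odd L) (hL3 : 3 ≤ L) (hL : Odd L ∧ 1 < L) {b c35 : ℝ} (hb : 0 < b) (hc35 : 0 < c35)
    (ν κ α β α' β' : Fin (d + 1)) (p : ℝ) (ne2At : ∀ {F : T4Family} {D : Datum F N}, key F D → (ℕ → ℝ) → List (ULoop F) → ℕ → NE2Objects₁₁) (RRec : RateRecordPred N)
    (hadm : ∀ (F : T4Family) (D : Datum F N) (g₀ : ℕ → ℝ) (os : List (ULoop F)) (R : RateCarriers N), RRec F D g₀ os R →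
      ∃ (h : key F D) (k : ℕ), R.ne2 = ne2OfRecord₁₁ (ne2At h g₀ os k))
    (h : ∀ (F : T4Family) (D : Datum F N) (h : key F D) (g₀ : ℕ → ℝ) (os : List (ULoop F)) (k : ℕ), ne2At h g₀ os k = allLayersBgObjects d hL b ν κ α β α' β' c35 p) :
    S_N15 RRec :=
  s_N15_of_admits ne2At RRec hadm fun F D hk g₀ os k => by rw [h F D hk g₀ os k]; exact n15At_allLayersBgObjects hd hLodd hL3 hL hb hc35 ν κ α β α' β' p

end Record

end Summit.QuantumFields.YangMills.BalabanUVNodes.N15.SiteLayerBg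

end
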